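import Literature.IUT.LogVolume.IsometryEmbeddingOrder
import Literature.IUT.LogVolume.IsometryStablePureTensorCriterion
import Literature.IUT.LogVolume.PacketMonomialBox
import HarnessLib

/-!
# MIXED packets with at most ONE non-tame slot: `(R_I)^∼` is a NORM BOX over the tame tensor basis — hence purely
# generated and fixed by EVERY tuple of factorwise `ℚ_p`-linear isometries: an isometric mover needs two wild slots

Classical local algebra (nothing disputed; the [IUTchIV] locator records where the abc-iut cell uses it).  abc-iut cell,
block E, seat abc-iut-E-t20 (gen 6): honest-scope rider to the R-J row Y-29b «mixed-packet converse» (E ROWS #1 R-20), its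
NECESSARY side.  [IUTchIV] Prop. 1.1 p. 9 attaches to a packet `V = ⊗_{ℚ_p, i ∈ I} k_i` of NOT NECESSARILY EQUAL `p`-adic fields
(«for `i ∈ I`, let `k_i ⊆ ℚ̄_p` be a finite extension of `ℚ_p`»; so are the packets of Thm. 1.10 Step (iv)–(v), p. 27) the maximal
`ℤ_p`-order `(R_I)^∼` (the tree's `normalizedPacket`).  Fix ONE slot `i₀`, its field `k_{i₀}` ARBITRARY, and let every other slot
carry a norm-unimodular trace-dual pair of `ℚ_p`-bases `(b^{(i)}, d^{(i)})` (`Tr(d_m b_{m'}) = δ`, `‖b_m‖·‖d_m‖ ≤ 1`) — these exist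
iff the slot is TAME, `¬ ∀ x, ‖x‖ ≤ 1 → ‖Tr x‖ < 1` (abc-iut-E-t42, `TameDualPair.exists_normUnimodular_dualPair_iff_not_wild`).
§1: characters `χ_τ⃗ : V →ₐ ℚ̄_p`, `⊗x_i ↦ Π τ_i(x_i)`, of norm `≤ 1` on `(R_I)^∼` (pure tensors with `Π‖c_i‖ ≤ 1` lie in `(R_I)^∼`:
abc-iut-E-t58's `MonomialBox.purePacket_mem_normalizedPacket_of_prod_norm_le`, whose MONOMIAL BOX needs incongruent monomial norms /
coprime totally ramified slots — a different sufficient condition; here the complement of ONE slot is TAME, unramified parts allowed).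
§2 THE BOX THEOREM (`mem_normalizedPacket_iff_exists_box`): splitting multi-indices at `i₀` (Mathlib `Equiv.piSplitAt`), every `z`
is `Σ_m ι_{i₀}(x_m)·e_m` over tame multi-indices `m` (`e_m = Π_{i≠i₀} ι_i(b^{(i)}_{m_i})`, `x_m ∈ k_{i₀}`), and
`τ₀(x_m) = Σ_{τ⃗'} χ_{(τ₀,τ⃗')}(z·Π_{i≠i₀} ι_i(d^{(i)}_{m_i}))` (trace expansion slot by slot), whence
`z ∈ (R_I)^∼ ⟺ ∀ m, ‖x_m‖·Π_{i≠i₀}‖b^{(i)}_{m_i}‖ ≤ 1` — the maximal order is a NORM BOX, whatever `k_{i₀}` is.  §3: so `(R_I)^∼` is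
additively generated by its integral pure tensors — abc-iut-E-t9's property `(PG)` (`IsometryStablePureTensorCriterion`, p490496,
whose §3 had it for an UNRAMIFIED complement, where `(R_I)^∼ = R_I`).  §4, hypotheses in the «not wild» currency: `(PG)` at every
packet with at most one non-tame slot (`mem_closure_pure_of_tame_off`), hence by E-t9's criterion EVERY factorwise-isometric tuple
fixes `(R_I)^∼` (`congr_image_normalizedPacket_eq_of_tame_off`, `not_exists_isometry_mover_of_tame_off`,
`congr_image_normalizedPacket_eq_of_subsingleton_wild`): **a mixed packet with at most one non-tame slot is never moved — an
isometric mover of `(R_I)^∼` needs two wild slots**, all `p`, all shapes (e.g. `ℚ₂(√2) ⊗ ℚ₂(∛2)` is STABLE although `(R)^∼ ⊋ R` and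
`ℚ₂(√2)` is a two-slot mover); the necessary counterpart of abc-iut-E-t46's sufficient `MixedSlotAscent.exists_isometries_mover_of_two_slots`
(p489526).  CONTAINERS only; no side taken on [IUTchIII] Cor. 3.12 / [IUTchIV] Thm. 1.10 or on any author.  PROOF-ONLY file
(no definition, no `Prop` fact, no `sorry`).
[cite: Mochizuki2012, IUTchIV Prop. 1.1 p. 9] [cite: SerreLocalFields1979, Ch. III §3, Prop. 7] [cite: NeukirchANT1999, Ch. II (4.8)]
-/

noncomputable section

open Module Function
open scoped TensorProduct

namespace Literature.IUT.LogVolume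

namespace TameComplement

variable (p : ℕ) [hp : Fact p.Prime] {I : Type} [Fintype I] [DecidableEq I]
  (k : I → Type) [∀ i, NontriviallyNormedField (k i)] [∀ i, NormedAlgebra ℚ_[p] (k i)]
  [∀ i, IsUltrametricDist (k i)] [∀ i, ProperSpace (k i)]

/-! ## §1 Characters of a packet -/

omit [DecidableEq I] [∀ i, IsUltrametricDist (k i)] [∀ i, ProperSpace (k i)] in
/-- **Characters.**  For embeddings `τ_i : k_i → ℚ̄_p` there is a `ℚ_p`-algebra map `χ_τ⃗ : ⊗_{ℚ_p} k_i → ℚ̄_p` with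
`χ_τ⃗(⊗ x_i) = Π_i τ_i(x_i)` (lift of the multiplicative multilinear map `x ↦ Π τ_i(x_i)`) — the factor-field embeddings of
[IUTchIV] Prop. 1.1's «tensor products decompose as direct sums». [cite: Mochizuki2012, IUTchIV Prop. 1.1 p. 9] -/
theorem exists_character (τ : ∀ i, k i →ₐ[ℚ_[p]] PadicAlgCl p) :
    ∃ χ : PacketAlgebra p k →ₐ[ℚ_[p]] PadicAlgCl p, ∀ x : Π i, k i, χ (purePacket p k x) = ∏ i, τ i (x i) := by
  let f : MultilinearMap ℚ_[p] k (PadicAlgCl p) :=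
    (MultilinearMap.mkPiAlgebra ℚ_[p] I (PadicAlgCl p)).compLinearMap fun i => (τ i).toLinearMap
  have hf : ∀ x, f x = ∏ i, τ i (x i) := fun x => by
    simp only [f, MultilinearMap.compLinearMap_apply, MultilinearMap.mkPiAlgebra_apply, AlgHom.toLinearMap_apply]
  have hmul : ∀ x y, f (x * y) = f x * f y := fun x y => by
    rw [hf, hf, hf, ← Finset.prod_mul_distrib]
    exact Finset.prod_congr rfl fun i _ => by rw [Pi.mul_apply, map_mul]
  exact ⟨PiTensorProduct.liftAlgHom f (by rw [hf]; exact Finset.prod_eq_one fun i _ => by rw [Pi.one_apply, map_one]) hmul,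
    fun x => by rw [purePacket, PiTensorProduct.liftAlgHom_apply, PiTensorProduct.lift.tprod, hf]⟩

omit [DecidableEq I] in
/-- Characters are `≤ 1` on the maximal order: `z ∈ (R_I)^∼ ⟹ ‖χ z‖ ≤ 1` (`χ z` is `ℤ_p`-integral in `ℚ̄_p`).
[cite: NeukirchANT1999, Ch. II (4.8)] -/
theorem norm_character_le_one [Nonempty I] (χ : PacketAlgebra p k →ₐ[ℚ_[p]] PadicAlgCl p)
    {z : PacketAlgebra p k} (hz : z ∈ normalizedPacket p k) : ‖χ z‖ ≤ 1 :=
  (Literature.NumberTheory.GaloisRepresentations.PadicAlgCl.norm_le_one_iff_isIntegral _).mpr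
    ((isIntegral_of_mem_normalizedPacket p k hz).map (χ.restrictScalars ℤ_[p]))

/-! ## §2 The box theorem along a distinguished slot `i₀` -/

section Box

variable (i₀ : I) {n : I → ℕ} (b d : ∀ i, Basis (Fin (n i)) ℚ_[p] (k i))

omit [∀ i, IsUltrametricDist (k i)] [∀ i, ProperSpace (k i)] in
/-- Pure tensors split at `i₀`: the pure tensor of the family joined from `x ∈ k_{i₀}` and `(y_i)_{i≠i₀}` (Mathlib
`Equiv.piSplitAt`) is `ι_{i₀}(x) · Π_{i≠i₀} ι_i(y_i)`. [cite: Mochizuki2012, IUTchIV Prop. 1.1 p. 9] -/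
theorem purePacket_piSplitAt_symm (x : k i₀) (y : ∀ i : {i // i ≠ i₀}, k i) :
    purePacket p k ((Equiv.piSplitAt i₀ k).symm (x, y)) = iota p k i₀ x * ∏ i : {i // i ≠ i₀}, iota p k i (y i) := by
  rw [purePacket_eq_prod_iota, Fintype.prod_eq_mul_prod_compl i₀]
  congr 1
  · simp [Equiv.piSplitAt]
  · exact (Finset.prod_subtype _ (fun i => by simp) _).trans
      (Finset.prod_congr rfl fun i _ => by congr 1; simp [Equiv.piSplitAt, i.2])

omit [∀ i, IsUltrametricDist (k i)] [∀ i, ProperSpace (k i)] in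
/-- … and so do norms: `Π_i ‖c_i‖ = ‖x‖ · Π_{i≠i₀} ‖y_i‖`. [folklore] -/
private theorem prod_norm_piSplitAt_symm (x : k i₀) (y : ∀ i : {i // i ≠ i₀}, k i) :
    ∏ i, ‖(Equiv.piSplitAt i₀ k).symm (x, y) i‖ = ‖x‖ * ∏ i : {i // i ≠ i₀}, ‖y i‖ := by
  rw [Fintype.prod_eq_mul_prod_compl i₀]
  congr 1
  · simp [Equiv.piSplitAt]
  · exact (Finset.prod_subtype _ (fun i => by simp) _).trans
      (Finset.prod_congr rfl fun i _ => by simp [Equiv.piSplitAt, i.2])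

omit [∀ i, IsUltrametricDist (k i)] [∀ i, ProperSpace (k i)] in
/-- The tensor basis (Mathlib `Basis.piTensorProduct`) at a split multi-index `(j, q')`: `⊗_i b^{(i)} = ι_{i₀}(b^{(i₀)}_j)·Π_{i≠i₀}
ι_i(b^{(i)}_{q'_i})`, i.e. the pure tensor of the joined family. [cite: Mochizuki2012, IUTchIV Prop. 1.1 p. 9] -/
theorem piTensorProduct_apply_piSplitAt_symm (j : Fin (n i₀)) (q' : ∀ i : {i // i ≠ i₀}, Fin (n i)) :
    Basis.piTensorProduct b ((Equiv.piSplitAt i₀ (fun i => Fin (n i))).symm (j, q')) =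
      purePacket p k ((Equiv.piSplitAt i₀ k).symm (b i₀ j, fun i => b i (q' i))) := by
  rw [Basis.piTensorProduct_apply, ← purePacket]
  congr 1
  funext i
  by_cases hi : i = i₀
  · subst hi; simp [Equiv.piSplitAt]
  · simp [Equiv.piSplitAt, hi]

omit [∀ i, IsUltrametricDist (k i)] [∀ i, ProperSpace (k i)] in
/-- **Decomposition along `i₀`.**  Every `z ∈ V` equals `Σ_m ι_{i₀}(x_m(z)) · Π_{i≠i₀} ι_i(b^{(i)}_{m_i})` over the multi-indices
`m = (m_i)_{i≠i₀}`, with `x_m(z) := Σ_j B.repr z (σ⁻¹(j, m)) • b^{(i₀)}_j ∈ k_{i₀}` (`B` the tensor basis, `σ = Equiv.piSplitAt i₀`).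
[cite: Mochizuki2012, IUTchIV Prop. 1.1 p. 9] -/
theorem eq_sum_iota_coeff_mul (z : PacketAlgebra p k) :
    z = ∑ m : (∀ i : {i // i ≠ i₀}, Fin (n i)),
      iota p k i₀ (∑ j, (Basis.piTensorProduct b).repr z ((Equiv.piSplitAt i₀ (fun i => Fin (n i))).symm (j, m)) • b i₀ j) *
        ∏ i : {i // i ≠ i₀}, iota p k i (b i (m i)) := by
  set B := Basis.piTensorProduct b with hB
  set σ := Equiv.piSplitAt i₀ (fun i => Fin (n i)) with hσ
  conv_lhs => rw [← B.sum_repr z, ← σ.symm.sum_comp, Fintype.sum_prod_type, Finset.sum_comm]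
  refine Finset.sum_congr rfl fun m _ => ?_
  rw [map_sum, Finset.sum_mul]
  refine Finset.sum_congr rfl fun j _ => ?_
  rw [hB, hσ, piTensorProduct_apply_piSplitAt_symm, purePacket_piSplitAt_symm, map_smul, smul_mul_assoc]

variable (hbd : ∀ i (m m' : Fin (n i)), Algebra.trace ℚ_[p] (k i) (d i m * b i m') = if m' = m then 1 else 0)
include hbd

omit [∀ i, IsUltrametricDist (k i)] [∀ i, ProperSpace (k i)] in
/-- **The `i₀`-coefficients through characters.**  If `Tr(d^{(i)}_m b^{(i)}_{m'}) = δ` at every slot, then for an embedding `τ₀` of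
`k_{i₀}`, a multi-index `m` and the characters `χ_{τ⃗'}` of the tuples `(τ₀, τ⃗')` (`τ⃗'` over ALL tuples of embeddings of the `k_i`,
`i ≠ i₀`): `τ₀(x_m(z)) = Σ_{τ⃗'} χ_{τ⃗'}(z · Π_{i≠i₀} ι_i(d^{(i)}_{m_i}))` — both sides are linear in `z`, and at the basis tensor of split index
`(j, q')` the right side is `τ₀(b^{(i₀)}_j)·Π_{i≠i₀} Σ_{τ'} τ'(b^{(i)}_{q'_i} d^{(i)}_{m_i}) = τ₀(b^{(i₀)}_j)·Π_{i≠i₀} Tr(d^{(i)}_{m_i} b^{(i)}_{q'_i})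
= τ₀(b^{(i₀)}_j)·[q' = m]` (`trace_eq_sum_embeddings`). [cite: SerreLocalFields1979, Ch. III §3] [cite: NeukirchANT1999, Ch. II (4.8)] -/
theorem algHom_coeff_eq_sum_character [∀ i, FiniteDimensional ℚ_[p] (k i)] (τ₀ : k i₀ →ₐ[ℚ_[p]] PadicAlgCl p)
    (χ : (∀ i : {i // i ≠ i₀}, k i →ₐ[ℚ_[p]] PadicAlgCl p) → (PacketAlgebra p k →ₐ[ℚ_[p]] PadicAlgCl p))
    (hχ : ∀ (t : ∀ i : {i // i ≠ i₀}, k i →ₐ[ℚ_[p]] PadicAlgCl p) (x : k i₀) (y : ∀ i : {i // i ≠ i₀}, k i),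
      χ t (purePacket p k ((Equiv.piSplitAt i₀ k).symm (x, y))) = τ₀ x * ∏ i, t i (y i))
    (m : ∀ i : {i // i ≠ i₀}, Fin (n i)) (z : PacketAlgebra p k) :
    τ₀ (∑ j, (Basis.piTensorProduct b).repr z ((Equiv.piSplitAt i₀ (fun i => Fin (n i))).symm (j, m)) • b i₀ j) =
      ∑ t : (∀ i : {i // i ≠ i₀}, k i →ₐ[ℚ_[p]] PadicAlgCl p), χ t (z * ∏ i : {i // i ≠ i₀}, iota p k i (d i (m i))) := by
  classical
  set B := Basis.piTensorProduct b with hB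
  set σ := Equiv.piSplitAt i₀ (fun i => Fin (n i)) with hσ
  let L : PacketAlgebra p k →ₗ[ℚ_[p]] PadicAlgCl p :=
    τ₀.toLinearMap ∘ₗ ∑ j : Fin (n i₀), LinearMap.toSpanSingleton ℚ_[p] (k i₀) (b i₀ j) ∘ₗ B.coord (σ.symm (j, m))
  let R : PacketAlgebra p k →ₗ[ℚ_[p]] PadicAlgCl p := ∑ t : (∀ i : {i // i ≠ i₀}, k i →ₐ[ℚ_[p]] PadicAlgCl p),
    (χ t).toLinearMap ∘ₗ LinearMap.mulRight ℚ_[p] (∏ i : {i // i ≠ i₀}, iota p k i (d i (m i)))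
  have hL : ∀ z, L z = τ₀ (∑ j, B.repr z (σ.symm (j, m)) • b i₀ j) := fun z => by
    simp only [L, LinearMap.comp_apply, AlgHom.toLinearMap_apply, LinearMap.sum_apply,
      LinearMap.toSpanSingleton_apply, Basis.coord_apply]
  have hR : ∀ z, R z = ∑ t : (∀ i : {i // i ≠ i₀}, k i →ₐ[ℚ_[p]] PadicAlgCl p),
      χ t (z * ∏ i : {i // i ≠ i₀}, iota p k i (d i (m i))) := fun z => by
    simp only [R, LinearMap.sum_apply, LinearMap.comp_apply, AlgHom.toLinearMap_apply, LinearMap.mulRight_apply]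
  suffices hLR : L = R by simpa only [hL, hR] using LinearMap.congr_fun hLR z
  refine B.ext fun q => ?_
  rw [hL, hR]
  obtain ⟨⟨j, q'⟩, rfl⟩ := σ.symm.surjective q
  have hleft : (∑ j' : Fin (n i₀), B.repr (B (σ.symm (j, q'))) (σ.symm (j', m)) • b i₀ j') = if q' = m then b i₀ j else 0 := by
    simp_rw [B.repr_self, Finsupp.single_apply, σ.symm.injective.eq_iff, Prod.mk.injEq]
    by_cases hq : q' = m
    · rw [if_pos hq, Finset.sum_eq_single j (fun j' _ hj' => by simp [Ne.symm hj']) (fun h => absurd (Finset.mem_univ j) h)]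
      simp [hq]
    · rw [if_neg hq]; exact Finset.sum_eq_zero fun j' _ => by simp [hq]
  have hprod : ∀ t : (∀ i : {i // i ≠ i₀}, k i →ₐ[ℚ_[p]] PadicAlgCl p),
      χ t (B (σ.symm (j, q')) * ∏ i : {i // i ≠ i₀}, iota p k i (d i (m i))) =
        τ₀ (b i₀ j) * ∏ i : {i // i ≠ i₀}, t i (b i (q' i) * d i (m i)) := fun t => by
    rw [hB, hσ, piTensorProduct_apply_piSplitAt_symm, purePacket_piSplitAt_symm, mul_assoc, ← Finset.prod_mul_distrib,
      ← hχ t, purePacket_piSplitAt_symm]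
    simp_rw [map_mul]
  have hps : (∑ t : (∀ i : {i // i ≠ i₀}, k i →ₐ[ℚ_[p]] PadicAlgCl p), ∏ i, t i (b i (q' i) * d i (m i))) =
      ∏ i : {i // i ≠ i₀}, ∑ t : k i →ₐ[ℚ_[p]] PadicAlgCl p, t (b i (q' i) * d i (m i)) :=
    (Fintype.prod_sum (fun (i : {i // i ≠ i₀}) (t : k i →ₐ[ℚ_[p]] PadicAlgCl p) => t (b i (q' i) * d i (m i)))).symm
  have htr : ∀ i : {i // i ≠ i₀}, ∑ t : k i →ₐ[ℚ_[p]] PadicAlgCl p, t (b i (q' i) * d i (m i)) =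
      if q' i = m i then 1 else 0 := fun i => by
    rw [← trace_eq_sum_embeddings (PadicAlgCl p), mul_comm, hbd]
    split_ifs <;> simp
  rw [hleft]
  simp_rw [hprod, ← Finset.mul_sum, hps, htr]
  by_cases hq : q' = m
  · subst hq; simp
  · obtain ⟨i, hi⟩ : ∃ i, q' i ≠ m i := by by_contra h; push Not at h; exact hq (funext h)
    rw [if_neg hq, map_zero, Finset.prod_eq_zero (Finset.mem_univ i) (by rw [if_neg hi]), mul_zero]

variable (hnorm : ∀ i, i ≠ i₀ → ∀ m : Fin (n i), ‖b i m‖ * ‖d i m‖ ≤ 1)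
include hnorm

/-- **Box bound.**  If moreover `‖b^{(i)}_m‖·‖d^{(i)}_m‖ ≤ 1` at the slots `i ≠ i₀` (TAME slots), then for `z ∈ (R_I)^∼` every
`i₀`-coefficient satisfies `‖x_m(z)‖·Π_{i≠i₀}‖b^{(i)}_{m_i}‖ ≤ 1`: `‖τ₀(x_m(z))‖ ≤ max_{τ⃗'} ‖χ(z)‖·Π‖τ'_i(d^{(i)}_{m_i})‖ ≤ Π_{i≠i₀}‖d^{(i)}_{m_i}‖`
(characters are `≤ 1` on `(R_I)^∼`, embeddings are isometries — campaign-S `norm_map_algHom`).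
[cite: SerreLocalFields1979, Ch. III §3, Prop. 7] [cite: Mochizuki2012, IUTchIV Prop. 1.1 p. 9] -/
theorem norm_coeff_mul_prod_le_one (m : ∀ i : {i // i ≠ i₀}, Fin (n i)) {z : PacketAlgebra p k}
    (hz : z ∈ normalizedPacket p k) :
    ‖∑ j, (Basis.piTensorProduct b).repr z ((Equiv.piSplitAt i₀ (fun i => Fin (n i))).symm (j, m)) • b i₀ j‖ *
      ∏ i : {i // i ≠ i₀}, ‖b i (m i)‖ ≤ 1 := by
  classical
  haveI : Nonempty I := ⟨i₀⟩
  haveI : ∀ i, FiniteDimensional ℚ_[p] (k i) := fun i => finiteDimensional p (k i)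
  obtain ⟨τ₀⟩ := EmbeddingOrder.nonempty_algHom_padicAlgCl (p := p) (K := k i₀)
  have hχ' : ∀ t : (∀ i : {i // i ≠ i₀}, k i →ₐ[ℚ_[p]] PadicAlgCl p),
      ∃ χ : PacketAlgebra p k →ₐ[ℚ_[p]] PadicAlgCl p, ∀ (x : k i₀) (y : ∀ i : {i // i ≠ i₀}, k i),
        χ (purePacket p k ((Equiv.piSplitAt i₀ k).symm (x, y))) = τ₀ x * ∏ i, t i (y i) := fun t => by
    obtain ⟨χ, hχ⟩ := exists_character p k ((Equiv.piSplitAt i₀ (fun i => k i →ₐ[ℚ_[p]] PadicAlgCl p)).symm (τ₀, t))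
    refine ⟨χ, fun x y => ?_⟩
    rw [hχ, Fintype.prod_eq_mul_prod_compl i₀]
    congr 1
    · simp [Equiv.piSplitAt]
    · exact (Finset.prod_subtype _ (fun i => by simp) _).trans
        (Finset.prod_congr rfl fun i _ => by simp [Equiv.piSplitAt, i.2])
  choose χ hχ using hχ'
  have hD : ∀ t, ‖χ t (z * ∏ i : {i // i ≠ i₀}, iota p k i (d i (m i)))‖ ≤ ∏ i : {i // i ≠ i₀}, ‖d i (m i)‖ := fun t => by
    have h1 := hχ t 1 fun i => d i (m i)
    rw [purePacket_piSplitAt_symm, map_one, one_mul, map_one, one_mul] at h1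
    rw [map_mul, h1, norm_mul, norm_prod]
    calc ‖χ t z‖ * ∏ i : {i // i ≠ i₀}, ‖t i (d i (m i))‖ ≤ 1 * ∏ i : {i // i ≠ i₀}, ‖d i (m i)‖ :=
          mul_le_mul (norm_character_le_one p k (χ t) hz)
            (Finset.prod_congr rfl fun i _ => norm_map_algHom (t i) _).le (by positivity) zero_le_one
      _ = _ := one_mul _
  have hx : ‖∑ j, (Basis.piTensorProduct b).repr z ((Equiv.piSplitAt i₀ (fun i => Fin (n i))).symm (j, m)) • b i₀ j‖ ≤
      ∏ i : {i // i ≠ i₀}, ‖d i (m i)‖ := by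
    rw [← norm_map_algHom τ₀, algHom_coeff_eq_sum_character p k i₀ b d hbd τ₀ χ hχ m z]
    exact IsUltrametricDist.norm_sum_le_of_forall_le_of_nonneg (by positivity) fun t _ => hD t
  calc _ ≤ (∏ i : {i // i ≠ i₀}, ‖d i (m i)‖) * ∏ i : {i // i ≠ i₀}, ‖b i (m i)‖ := by gcongr
    _ = ∏ i : {i // i ≠ i₀}, (‖b i (m i)‖ * ‖d i (m i)‖) := by
        rw [← Finset.prod_mul_distrib]; exact Finset.prod_congr rfl fun i _ => mul_comm _ _
    _ ≤ ∏ _i : {i // i ≠ i₀}, (1 : ℝ) := Finset.prod_le_prod (fun i _ => by positivity) fun i _ => hnorm i i.2 (m i)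
    _ = 1 := by simp

/-- **THE BOX THEOREM.**  At a packet whose slots off `i₀` carry norm-unimodular trace-dual pairs `(b^{(i)}, d^{(i)})` — TAME slots —
`z ∈ (R_I)^∼ ⟺ z = Σ_m ι_{i₀}(x_m)·Π_{i≠i₀} ι_i(b^{(i)}_{m_i})` with `x_m ∈ k_{i₀}`, `‖x_m‖·Π_{i≠i₀}‖b^{(i)}_{m_i}‖ ≤ 1`: the maximal order is a
NORM BOX over the tame tensor basis (so it is `ℤ_p`-spanned by integral pure tensors), WHATEVER the field `k_{i₀}`.
[cite: Mochizuki2012, IUTchIV Prop. 1.1 p. 9] [cite: SerreLocalFields1979, Ch. III §3, Prop. 7] -/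
theorem mem_normalizedPacket_iff_exists_box (z : PacketAlgebra p k) :
    z ∈ normalizedPacket p k ↔ ∃ x : (∀ i : {i // i ≠ i₀}, Fin (n i)) → k i₀,
      (∀ m, ‖x m‖ * ∏ i : {i // i ≠ i₀}, ‖b i (m i)‖ ≤ 1) ∧
        z = ∑ m, iota p k i₀ (x m) * ∏ i : {i // i ≠ i₀}, iota p k i (b i (m i)) := by
  haveI : Nonempty I := ⟨i₀⟩
  refine ⟨fun hz => ⟨_, fun m => norm_coeff_mul_prod_le_one p k i₀ b d hbd hnorm m hz, eq_sum_iota_coeff_mul p k i₀ b z⟩, ?_⟩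
  rintro ⟨x, hx, rfl⟩
  refine sum_mem fun m _ => ?_
  rw [← purePacket_piSplitAt_symm]
  exact MonomialBox.purePacket_mem_normalizedPacket_of_prod_norm_le p k (by rw [prod_norm_piSplitAt_symm]; exact hx m)

/-! ## §3 The box is purely generated: abc-iut-E-t9's `(PG)` at every tame-complement packet -/

/-- **Tame complement ⟹ `(R_I)^∼` is PURELY GENERATED** — abc-iut-E-t9's lattice property `(PG)` of
`IsometryStablePureTensorCriterion` (p490496), in its exact currency: every `z ∈ (R_I)^∼` lies in the additive closure of the
INTEGRAL PURE TENSORS of `(R_I)^∼` (each box term `ι_{i₀}(x_m)·e_m` is one).  E-t9's §3 had this for an UNRAMIFIED complement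
(`e_i = 1` off one slot, where `(R_I)^∼ = R_I`); here the complement is merely TAME and `(R_I)^∼ ⊋ R_I` in general.
[cite: Mochizuki2012, IUTchIV Prop. 1.1 p. 9] [cite: SerreLocalFields1979, Ch. III §3, Prop. 7] -/
theorem mem_closure_pure_of_box {z : PacketAlgebra p k} (hz : z ∈ normalizedPacket p k) :
    z ∈ AddSubgroup.closure
      {t : PacketAlgebra p k | t ∈ normalizedPacket p k ∧ ∃ x : Π i, k i, t = purePacket p k x} := by
  haveI : Nonempty I := ⟨i₀⟩
  obtain ⟨x, hx, rfl⟩ := (mem_normalizedPacket_iff_exists_box p k i₀ b d hbd hnorm z).mp hz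
  refine AddSubgroup.sum_mem _ fun m _ => AddSubgroup.subset_closure ⟨?_, _, (purePacket_piSplitAt_symm p k i₀ _ _).symm⟩
  rw [← purePacket_piSplitAt_symm]
  exact MonomialBox.purePacket_mem_normalizedPacket_of_prod_norm_le p k (by rw [prod_norm_piSplitAt_symm]; exact hx m)

end Box

/-! ## §4 The tame-complement theorems, hypotheses in the tree's «not wild» currency -/

/-- **`(PG)` at every packet with at most one non-tame slot.**  Let `k_i` (`i ∈ I`) be `p`-adic fields with every slot `i ≠ i₀`
TAME (`¬ ∀ x, ‖x‖ ≤ 1 → ‖Tr_{k_i/ℚ_p} x‖ < 1`, i.e. `Tr(𝒪_{k_i}) = ℤ_p`), the slot `i₀` ARBITRARY.  Then `(R_I)^∼` is additively generated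
by its integral pure tensors (norm-unimodular trace-dual pairs off `i₀` by abc-iut-E-t42's
`TameDualPair.exists_normUnimodular_dualPair_of_not_wild`, any trace-dual pair at `i₀`, then `mem_closure_pure_of_box`).
[cite: Mochizuki2012, IUTchIV Prop. 1.1 p. 9] [cite: SerreLocalFields1979, Ch. III §3, Prop. 7] -/
theorem mem_closure_pure_of_tame_off (i₀ : I)
    (htame : ∀ i, i ≠ i₀ → ¬ ∀ x : k i, ‖x‖ ≤ 1 → ‖Algebra.trace ℚ_[p] (k i) x‖ < 1) :
    ∀ z ∈ normalizedPacket p k, z ∈ AddSubgroup.closure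
      {t : PacketAlgebra p k | t ∈ normalizedPacket p k ∧ ∃ x : Π i, k i, t = purePacket p k x} := by
  classical
  have hdata : ∀ i, ∃ (n : ℕ) (b d : Basis (Fin n) ℚ_[p] (k i)),
      (∀ m m', Algebra.trace ℚ_[p] (k i) (d m * b m') = if m' = m then 1 else 0) ∧ (i ≠ i₀ → ∀ m, ‖b m‖ * ‖d m‖ ≤ 1) := by
    intro i
    by_cases hi : i = i₀
    · haveI := finiteDimensional p (k i)
      obtain ⟨d₀, hd₀⟩ := exists_traceDual_basis (p := p) (Module.finBasis ℚ_[p] (k i))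
      exact ⟨_, _, d₀, hd₀, fun h => absurd hi h⟩
    · obtain ⟨n, b, d, hbd, hn⟩ := TameDualPair.exists_normUnimodular_dualPair_of_not_wild (htame i hi)
      exact ⟨n, b, d, hbd, fun _ => hn⟩
  choose n b d hbd hnorm using hdata
  exact fun z hz => mem_closure_pure_of_box p k i₀ b d hbd hnorm hz

/-- **MIXED PACKETS WITH AT MOST ONE NON-TAME SLOT ARE STABLE**: under the same hypotheses EVERY tuple `(g_i)` of factorwise
`ℚ_p`-linear isometries has `(⊗_i g_i)((R_I)^∼) = (R_I)^∼` — `(PG)` (`mem_closure_pure_of_tame_off`) fed into abc-iut-E-t9's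
`PureTensorCriterion.congr_image_normalizedPacket_eq_of_closure_pure` (an isometry tuple sends an integral pure tensor to one with the
same slot norms).  All `p`, all shapes, `k_{i₀}` arbitrary: «bad ⊗ ℚ_p», «bad ⊗ unramified» (E-t9's §3, lane 2's paper examples) and
now every «anything ⊗ (TAME slots)» — e.g. `ℚ₂(√2) ⊗ ℚ₂(∛2)`, where `(R)^∼ ⊋ R` — are STABLE.
[cite: Mochizuki2012, IUTchIV Prop. 1.1 p. 9] [cite: SerreLocalFields1979, Ch. III §3, Prop. 7] -/
theorem congr_image_normalizedPacket_eq_of_tame_off (i₀ : I)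
    (htame : ∀ i, i ≠ i₀ → ¬ ∀ x : k i, ‖x‖ ≤ 1 → ‖Algebra.trace ℚ_[p] (k i) x‖ < 1)
    (g : ∀ i, k i ≃ₗ[ℚ_[p]] k i) (hg : ∀ i x, ‖g i x‖ = ‖x‖) :
    (PiTensorProduct.congr g : PacketAlgebra p k ≃ₗ[ℚ_[p]] PacketAlgebra p k) ''
        (normalizedPacket p k : Set (PacketAlgebra p k)) = normalizedPacket p k :=
  PureTensorCriterion.congr_image_normalizedPacket_eq_of_closure_pure p k (mem_closure_pure_of_tame_off p k i₀ htame) g hg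

/-- **… hence NO factorwise-isometric mover exists at such a packet**: an isometric mover of `(R_I)^∼` needs AT LEAST TWO
non-tame (wild) slots — the necessary counterpart of abc-iut-E-t46's sufficient `MixedSlotAscent.exists_isometries_mover_of_two_slots`
(two slots receiving a common bad field ⟹ moved), and the widening of E-t9's `not_exists_isometry_mover_of_absRamificationIdx_eq_one`
from unramified to tame complements. [cite: Mochizuki2012, IUTchIV Prop. 1.1 p. 9] -/
theorem not_exists_isometry_mover_of_tame_off (i₀ : I)
    (htame : ∀ i, i ≠ i₀ → ¬ ∀ x : k i, ‖x‖ ≤ 1 → ‖Algebra.trace ℚ_[p] (k i) x‖ < 1) :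
    ¬ ∃ (g : ∀ i, k i ≃ₗ[ℚ_[p]] k i) (_ : ∀ i x, ‖g i x‖ = ‖x‖) (z : PacketAlgebra p k), z ∈ normalizedPacket p k ∧
        (PiTensorProduct.congr g : PacketAlgebra p k ≃ₗ[ℚ_[p]] PacketAlgebra p k) z ∉ normalizedPacket p k :=
  PureTensorCriterion.not_exists_isometry_mover_of_closure_pure p k (mem_closure_pure_of_tame_off p k i₀ htame)

/-- **At most one wild slot, none distinguished** (`I` non-empty; «wild» = `∀ x, ‖x‖ ≤ 1 → ‖Tr x‖ < 1`): if any two wild slots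
coincide then every factorwise-isometric tuple fixes `(R_I)^∼` (the theorem at a wild `i₀` if there is one, else at any `i₀`).
[cite: Mochizuki2012, IUTchIV Prop. 1.1 p. 9] -/
theorem congr_image_normalizedPacket_eq_of_subsingleton_wild [Nonempty I]
    (h : ∀ i j, (∀ x : k i, ‖x‖ ≤ 1 → ‖Algebra.trace ℚ_[p] (k i) x‖ < 1) →
      (∀ x : k j, ‖x‖ ≤ 1 → ‖Algebra.trace ℚ_[p] (k j) x‖ < 1) → i = j)
    (g : ∀ i, k i ≃ₗ[ℚ_[p]] k i) (hg : ∀ i x, ‖g i x‖ = ‖x‖) :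
    (PiTensorProduct.congr g : PacketAlgebra p k ≃ₗ[ℚ_[p]] PacketAlgebra p k) ''
        (normalizedPacket p k : Set (PacketAlgebra p k)) = normalizedPacket p k := by
  by_cases hw : ∃ i₀, ∀ x : k i₀, ‖x‖ ≤ 1 → ‖Algebra.trace ℚ_[p] (k i₀) x‖ < 1
  · obtain ⟨i₀, hi₀⟩ := hw
    exact congr_image_normalizedPacket_eq_of_tame_off p k i₀ (fun i hi hwi => hi (h i i₀ hwi hi₀)) g hg
  · push Not at hw
    obtain ⟨i₀⟩ := ‹Nonempty I›
    refine congr_image_normalizedPacket_eq_of_tame_off p k i₀ (fun i _ hwi => ?_) g hg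
    obtain ⟨x, hx1, hx2⟩ := hw i
    exact absurd (hwi x hx1) (not_lt.mpr hx2)

end TameComplement

end Literature.IUT.LogVolume

end
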